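import Summits.BirchSwinnertonDyer.BirchSwinnertonDyer.Theorems.PrintCf2RubinValueTwoLinePinDefectLineIdentity
import Summits.BirchSwinnertonDyer.BirchSwinnertonDyer.Theorems.PrintCf2RubinValueTwoLinePinSocket
import HarnessLib

/-!
# M-LINE-PIN, part 8: THE `v`-LINE PINS THE EULER EXPONENT TOO — (LS)_v is an OUTPUT, not an input:
# `(p^a · F^J) = (p^b · G₂)` (Q) + `π_v(ch D₂.X) = E^c · ch D₁.X` ((C)∘(C2b), exponent FREE) + `(ch D₁.X)^J = (G₁)` (M)
# + `π_v(G₂) = E^J · G₁` (A) ⟹ `c = 1`, `a = b`, and `(ch_{Λ₂} D₂.X)^J = (G₂)`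

Cell `bsd-print-cf2`, width seat `bsd-line-cf2c-w8` g4 (prover-bsd-line-cf2c-w8-g4-0), planner g19's named piece M-LINE-PIN (skeleton SPEC
`M-LINE-PIN-SKELETON-SPEC-g19.md` §1–§2). The SPEC lists under `stub_defectVbar` the residual «ONE number: λ(ker φ̄) = 1 = (LS)_v (Poitou–Tate on
the `v`-line + Leopoldt)». THIS FILE REMOVES IT: in the socket's line `B = 𝒪_{ℂ_p}⟦T⟧` the Euler factor `E = T + e₀` (`e₀ = 1 − u`, a NON-UNIT
of `𝒪_{ℂ_p}` since `p ∣ u − 1`) is coprime to `p` in the only sense needed — an elementary coefficient comparison shows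
`(p^a · E^c) = (p^b · E) ⟹ c = 1` in `𝒪⟦T⟧` for ANY domain `𝒪` (`eq_one_of_associated_C_mul_X_add_C_pow`; no UFD, no Weierstrass preparation,
no evaluation at `−e₀`). Hence the ⊗ℚ-form (Q) of the two-variable main conjecture, restricted to the `v`-line, pins the exponent `c` of the
`v̄`-defect term AND the power of `p` simultaneously: the algebraic corank statement (LS)_v «`corank_{ℤ_p}(coker of the slot-1 control) = 1`»
becomes a COROLLARY (`zpCorank C p = 1` in `zpCorank_eq_one_and_map_charIdeal_eq_span_of_powForm`), and the line identity `hline` of the socket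
p695043 `map_charIdeal_eq_span_of_powForm_of_firstLine` is produced here instead of assumed. `--supports stmt-BirchSwinnertonDyer-24086 --as helper`,
Theses-free. HONEST FRAMING: algebra + assembly; the displayed inputs that remain are exactly (Q) (`hQ`), (M) (`hM`, Müller 2020 Thm 1.3 in the
typed form `Muller2020.thm13_exists_nuBranch_charIdeal_eq.exists_span_eq`), (A) (`hA`: `π_v(G₂)` and `E^J · G₁` generate the same ideal of
`𝒪_{ℂ_p}⟦T⟧` — de Shalit II.4.12 restriction, ty2's `Muller2020.IsNuBranch.insert_of_avatarAt_inv` + period rigidity), S3n′ (`hfin`), `[Finite g.ker]`,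
the even local class `hI`. No summit statement is proved by this seat; BSD is not proved by any of this. THEOREMS ONLY (no definition, no named fact,
no `sorry`).

* `coeff_X_add_C_pow` — `coeff_k (T + e₀)^N = e₀^{N−k} · (N choose k)` in `𝒪⟦T⟧`.
* `eq_one_of_associated_C_mul_X_add_C_pow` — `𝒪` a domain, `e₀` a non-unit, `c₁ c₂ ≠ 0`: `(c₁ · (T+e₀)^m) = (c₂ · (T+e₀))` as ideals ⟹ `m = 1`.
* `eq_one_and_span_eq_of_span_pow_mul_eq` — the abstract pin: `(k^a f) = (k^b g)`, `(f) = (E)^m (G₁)`, `(g) = (E)(G₁)`, `G₁ ≠ 0` ⟹ `m = 1 ∧ (f) = (g)`.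
* `eq_one_and_map_charIdeal_eq_span_of_powForm` — socket currency: (Q) + `π(ch_{Λ₂} D.X) = ((1+T) − u)^c · I₁` in `Λ` + `I₁^J = (G₁)` + (A)
  ⟹ `c = 1 ∧ a = b ∧ (ch_{Λ₂} D.X).map (map (map J)) = (G₂)`; and `map_constantCoeff_charIdeal_ne_bot_of_powForm` — `(ch)(T₁,0) ≠ 0` for free.
* `zpCorank_eq_one_and_map_charIdeal_eq_span_of_powForm` — with part 7: the slot-1 control data + (Q) + (M) + (A) + S3n′
  ⟹ `D₂.X` torsion ∧ `corank_{ℤ_p} C = 1` ((LS)_v PROVED as a by-product) ∧ `a = b` ∧ the crux's clause `(ch_{Λ₂} D₂.X).map (map (map J)) = (G₂)`.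
presearch: the `k`-power pin is the tree's p694240 (Washington §13.2 shape); the Euler-exponent pin is folklore coefficient algebra — none in print needed
(queries: "characteristic ideal restriction Euler factor exponent two-variable", "specialization characteristic power series line"; corpus+galaxy: none relevant).
beyond-print theorem: no.

References: [Washington1997] §13.2; [GreenbergVatsal2000] §2 Prop. (2.4); [deShalit1987] II.4.12; [Mueller2020MCSplitTwo] Thm. 1.3.
-/

noncomputable section

open scoped Classical Pointwise AddSubgroup NumberField

-- the summit namespace `Summit.BirchSwinnertonDyer.BirchSwinnertonDyer` repeats the problem name by design (D-0017)
set_option linter.dupNamespace false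
set_option autoImplicit false

open NumberField IsDedekindDomain Field Literature.NumberTheory.GaloisRepresentations
  Literature.NumberTheory.EllipticCurves Literature.NumberTheory.EllipticCurves.Module
  Literature.NumberTheory.EllipticCurves.IwasawaAlgebra Literature.NumberTheory.EllipticCurves.GreenbergSelmer
  Literature.NumberTheory.EllipticCurves.GreenbergVatsal2000 Literature.NumberTheory.EllipticCurves.KellerYin2024
  Literature.NumberTheory.EllipticCurves.IwasawaDual
open Summit.BirchSwinnertonDyer.BirchSwinnertonDyer.Theorems.PrintCf2

namespace Summit.BirchSwinnertonDyer.BirchSwinnertonDyer.Theorems.PrintCf2.LinePin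

/-! ## §1. Coefficient algebra in `𝒪⟦T⟧`: `(c₁ · (T+e₀)^m) = (c₂ · (T+e₀))` forces `m = 1` -/

section Algebra

variable {𝒪 : Type*} [CommRing 𝒪]

/-- `coeff_k (T + e₀)^N = e₀^{N−k} · (N choose k)` in `𝒪⟦T⟧` (binomial theorem, via polynomials). [folklore] -/
theorem coeff_X_add_C_pow (e₀ : 𝒪) (N k : ℕ) :
    PowerSeries.coeff k ((PowerSeries.X + PowerSeries.C e₀ : PowerSeries 𝒪) ^ N) = e₀ ^ (N - k) * (N.choose k : 𝒪) := by
  have h : (PowerSeries.X + PowerSeries.C e₀ : PowerSeries 𝒪) = ((Polynomial.X + Polynomial.C e₀ : Polynomial 𝒪) : PowerSeries 𝒪) := by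
    rw [Polynomial.coe_add, Polynomial.coe_X, Polynomial.coe_C]
  rw [h, ← Polynomial.coe_pow, Polynomial.coeff_coe, Polynomial.coeff_X_add_C_pow]

/-- `T + e₀ ≠ 0` in `𝒪⟦T⟧` (its `T`-coefficient is `1`), `𝒪` non-trivial. [folklore] -/
theorem X_add_C_ne_zero [Nontrivial 𝒪] (e₀ : 𝒪) : (PowerSeries.X + PowerSeries.C e₀ : PowerSeries 𝒪) ≠ 0 := by
  intro h
  have h1 := congrArg (PowerSeries.coeff 1) h
  rw [map_add, PowerSeries.coeff_one_X, PowerSeries.coeff_C, if_neg one_ne_zero, add_zero, map_zero] at h1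
  exact one_ne_zero h1

variable [IsDomain 𝒪]

/-- **THE EULER-EXPONENT PIN.** `𝒪` a domain, `e₀ ∈ 𝒪` a NON-UNIT, `c₁, c₂ ≠ 0`: if `c₁ · (T + e₀)^m` and `c₂ · (T + e₀)` generate the same
ideal of `𝒪⟦T⟧` then `m = 1`. (`m = 0`: comparing the `T⁰, T¹` coefficients of `c₁ w = c₂ (T + e₀)` gives `w₀ = w₁ e₀`, a non-unit constant
term of the unit `w`; `m ≥ 2`: cancel `T + e₀` and compare the `T⁰, T^{m−1}` coefficients of `c₂ w = c₁ (T+e₀)^{m−1}`: `w₀ = w_{m−1} e₀^{m−1}`.)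
No unique factorisation and no `p`-adic completeness of `𝒪` is used (`𝒪 = 𝒪_{ℂ_p}` is neither noetherian nor a UFD). [folklore] -/
theorem eq_one_of_associated_C_mul_X_add_C_pow {e₀ c₁ c₂ : 𝒪} (he₀ : ¬ IsUnit e₀) (hc₁ : c₁ ≠ 0) (hc₂ : c₂ ≠ 0) {m : ℕ}
    (h : Associated (PowerSeries.C c₁ * (PowerSeries.X + PowerSeries.C e₀) ^ m)
      (PowerSeries.C c₂ * (PowerSeries.X + PowerSeries.C e₀))) : m = 1 := by
  have hE1 : PowerSeries.coeff 1 (PowerSeries.X + PowerSeries.C e₀ : PowerSeries 𝒪) = 1 := by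
    have := coeff_X_add_C_pow e₀ 1 1
    rwa [pow_one, Nat.sub_self, pow_zero, one_mul, Nat.choose_self, Nat.cast_one] at this
  have hE00 : PowerSeries.coeff 0 (PowerSeries.X + PowerSeries.C e₀ : PowerSeries 𝒪) = e₀ := by
    have := coeff_X_add_C_pow e₀ 1 0
    rwa [pow_one, Nat.sub_zero, pow_one, Nat.choose_zero_right, Nat.cast_one, mul_one] at this
  rcases m with _ | _ | n
  · -- `m = 0`
    exfalso
    obtain ⟨w, hw⟩ := h
    rw [pow_zero, mul_one] at hw
    have hw0 : IsUnit (PowerSeries.coeff 0 (↑w : PowerSeries 𝒪)) := by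
      rw [PowerSeries.coeff_zero_eq_constantCoeff_apply]
      exact PowerSeries.isUnit_constantCoeff _ w.isUnit
    have h0 := congrArg (PowerSeries.coeff 0) hw
    have h1 := congrArg (PowerSeries.coeff 1) hw
    rw [PowerSeries.coeff_C_mul, PowerSeries.coeff_C_mul, hE00] at h0
    rw [PowerSeries.coeff_C_mul, PowerSeries.coeff_C_mul, hE1, mul_one] at h1
    -- `w₀ = w₁ e₀`
    have hw01 : PowerSeries.coeff 0 (↑w : PowerSeries 𝒪) = PowerSeries.coeff 1 (↑w : PowerSeries 𝒪) * e₀ :=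
      mul_left_cancel₀ hc₁ (by rw [h0, ← mul_assoc, h1])
    rw [hw01] at hw0
    exact he₀ (isUnit_of_mul_isUnit_right hw0)
  · rfl
  · -- `m = n + 2`
    exfalso
    obtain ⟨w, hw⟩ := h.symm
    have hE0 := X_add_C_ne_zero (𝒪 := 𝒪) e₀
    have hw' : (PowerSeries.X + PowerSeries.C e₀) * (PowerSeries.C c₂ * (w : PowerSeries 𝒪)) =
        (PowerSeries.X + PowerSeries.C e₀) * (PowerSeries.C c₁ * (PowerSeries.X + PowerSeries.C e₀) ^ (n + 1)) := by
      calc (PowerSeries.X + PowerSeries.C e₀) * (PowerSeries.C c₂ * (w : PowerSeries 𝒪))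
          = PowerSeries.C c₂ * (PowerSeries.X + PowerSeries.C e₀) * (w : PowerSeries 𝒪) := by ring
        _ = PowerSeries.C c₁ * (PowerSeries.X + PowerSeries.C e₀) ^ (n + 1 + 1) := hw
        _ = (PowerSeries.X + PowerSeries.C e₀) * (PowerSeries.C c₁ * (PowerSeries.X + PowerSeries.C e₀) ^ (n + 1)) := by ring
    have hc := mul_left_cancel₀ hE0 hw'
    have hw0 : IsUnit (PowerSeries.coeff 0 (↑w : PowerSeries 𝒪)) := by
      rw [PowerSeries.coeff_zero_eq_constantCoeff_apply]
      exact PowerSeries.isUnit_constantCoeff _ w.isUnit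
    have hN := congrArg (PowerSeries.coeff (n + 1)) hc
    have h0 := congrArg (PowerSeries.coeff 0) hc
    rw [PowerSeries.coeff_C_mul, PowerSeries.coeff_C_mul, coeff_X_add_C_pow, Nat.sub_self, pow_zero, one_mul, Nat.choose_self,
      Nat.cast_one, mul_one] at hN
    rw [PowerSeries.coeff_C_mul, PowerSeries.coeff_C_mul, coeff_X_add_C_pow, Nat.sub_zero, Nat.choose_zero_right, Nat.cast_one,
      mul_one] at h0
    -- `w₀ = w_{n+1} e₀^{n+1}`
    have hw0N : PowerSeries.coeff 0 (↑w : PowerSeries 𝒪) = PowerSeries.coeff (n + 1) (↑w : PowerSeries 𝒪) * e₀ ^ (n + 1) :=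
      mul_left_cancel₀ hc₂ (by rw [h0, ← mul_assoc, hN])
    rw [hw0N] at hw0
    exact he₀ ((isUnit_pow_iff (Nat.succ_ne_zero n)).mp (isUnit_of_mul_isUnit_right hw0))

/-- **THE ABSTRACT LINE PIN WITH FREE EXPONENT.** In `𝒪⟦T⟧` (`𝒪` a domain), with `E = T + e₀` (`e₀` a non-unit) and non-zero constants `k₁, k₂`:
`(k₁ f) = (k₂ g)`, `(f) = (E)^m · (G₁)`, `(g) = (E) · (G₁)`, `G₁ ≠ 0` ⟹ `m = 1` and `(f) = (g)` (and `f ≠ 0`). [folklore] -/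
theorem eq_one_and_span_eq_of_span_C_mul_eq {e₀ k₁ k₂ : 𝒪} (he₀ : ¬ IsUnit e₀) (hk₁ : k₁ ≠ 0) (hk₂ : k₂ ≠ 0)
    {f g G₁ : PowerSeries 𝒪} (hG₁ : G₁ ≠ 0) {m : ℕ}
    (hk : Ideal.span ({PowerSeries.C k₁ * f} : Set (PowerSeries 𝒪)) = Ideal.span {PowerSeries.C k₂ * g})
    (hf : Ideal.span ({f} : Set (PowerSeries 𝒪)) = Ideal.span {PowerSeries.X + PowerSeries.C e₀} ^ m * Ideal.span {G₁})
    (hg : Ideal.span ({g} : Set (PowerSeries 𝒪)) = Ideal.span {PowerSeries.X + PowerSeries.C e₀} * Ideal.span {G₁}) :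
    m = 1 ∧ Ideal.span ({f} : Set (PowerSeries 𝒪)) = Ideal.span {g} ∧ f ≠ 0 := by
  rw [Ideal.span_singleton_pow, Ideal.span_singleton_mul_span_singleton] at hf
  rw [Ideal.span_singleton_mul_span_singleton] at hg
  have hfa : Associated f ((PowerSeries.X + PowerSeries.C e₀) ^ m * G₁) := Ideal.span_singleton_eq_span_singleton.mp hf
  have hga : Associated g ((PowerSeries.X + PowerSeries.C e₀) * G₁) := Ideal.span_singleton_eq_span_singleton.mp hg
  have hka : Associated (PowerSeries.C k₁ * f) (PowerSeries.C k₂ * g) := Ideal.span_singleton_eq_span_singleton.mp hk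
  -- `k₁ E^m G₁ ~ k₂ E G₁`
  have h1 : Associated (PowerSeries.C k₁ * (PowerSeries.X + PowerSeries.C e₀) ^ m * G₁)
      (PowerSeries.C k₂ * (PowerSeries.X + PowerSeries.C e₀) * G₁) := by
    rw [mul_assoc, mul_assoc]
    exact ((hfa.mul_left (PowerSeries.C k₁)).symm.trans hka).trans (hga.mul_left (PowerSeries.C k₂))
  have h2 : Associated (PowerSeries.C k₁ * (PowerSeries.X + PowerSeries.C e₀) ^ m)
      (PowerSeries.C k₂ * (PowerSeries.X + PowerSeries.C e₀)) :=
    Associated.of_mul_right h1 (Associated.refl G₁) hG₁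
  have hm : m = 1 := eq_one_of_associated_C_mul_X_add_C_pow he₀ hk₁ hk₂ h2
  subst hm
  rw [pow_one] at hf hfa
  refine ⟨rfl, by rw [hf, hg], ?_⟩
  rw [hfa.ne_zero_iff]
  exact mul_ne_zero (X_add_C_ne_zero e₀) hG₁

end Algebra

/-! ## §2. The socket's currency: `Λ₂ = ℤ_p⟦T₂⟧⟦T₁⟧ → Λ = ℤ_p⟦T⟧ → B = 𝒪_{ℂ_p}⟦T⟧` -/

section Socket

universe u

variable {K : Type u} [Field K] [NumberField K] {p : ℕ} [Fact p.Prime] {κ₁ κ₂ : ZpExtension K p}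
  {M : Type u} [AddCommGroup M] [DistribMulAction (absoluteGaloisGroup K) M] [TopologicalSpace M] [DiscreteTopology M]
  {vbar : HeightOneSpectrum (𝓞 K)} {γ₁ γ₂ : absoluteGaloisGroup K}

/-- `1 − u` is a non-unit of `𝒪_{ℂ_p}` when `p ∣ u − 1` (`p` is a non-unit there). [folklore] -/
theorem not_isUnit_one_sub_intCast_padicComplexInt {u : ℤ} (hpu : (p : ℤ) ∣ u - 1) :
    ¬ IsUnit ((1 : PadicComplexInt p) - (u : PadicComplexInt p)) := by
  obtain ⟨k, hk⟩ := hpu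
  have hz : (1 : ℤ) - u = (p : ℤ) * (-k) := by linarith
  have h : (1 : PadicComplexInt p) - (u : PadicComplexInt p) = ((p : ℕ) : PadicComplexInt p) * ((-k : ℤ) : PadicComplexInt p) := by
    have := congrArg (Int.cast : ℤ → PadicComplexInt p) hz
    push_cast at this ⊢
    exact this
  rw [h]
  exact fun hu ↦ SignedBaseChangeK1RationalAnchor.not_isUnit_natCast_padicComplexInt (p := p) (isUnit_of_mul_isUnit_left hu)

/-- The Euler factor `(1+T) − u` of `B = 𝒪⟦T⟧` is `T + (1 − u)`. [folklore] -/
theorem one_add_X_sub_intCast_eq {𝒪 : Type*} [CommRing 𝒪] (u : ℤ) :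
    ((1 : PowerSeries 𝒪) + PowerSeries.X) - (u : PowerSeries 𝒪) = PowerSeries.X + PowerSeries.C ((1 : 𝒪) - (u : 𝒪)) := by
  rw [map_sub, map_one, map_intCast]
  ring

/-- **(Q) READ ON THE FIRST SLOT'S LINE**: `(p^a · F^J) = (p^b · G₂)` in `𝒪_{ℂ_p}⟦T₂⟧⟦T₁⟧` gives
`(C(p^a) · (F(T₁,0))^J) = (C(p^b) · G₂(T₁,0))` in `𝒪_{ℂ_p}⟦T₁⟧`. [cite: Washington1997, §13.2 (shape only)] -/
theorem span_C_pow_mul_line_eq_of_powForm (J : ℤ_[p] →+* PadicComplexInt p) (G₂ : PowerSeries (PowerSeries (PadicComplexInt p)))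
    (F : IwasawaAlgebra₂ p) {a b : ℕ}
    (hQ : Ideal.span ({((p : ℕ) : PowerSeries (PowerSeries (PadicComplexInt p))) ^ a *
        PowerSeries.map (PowerSeries.map J) F} : Set (PowerSeries (PowerSeries (PadicComplexInt p)))) =
      Ideal.span {((p : ℕ) : PowerSeries (PowerSeries (PadicComplexInt p))) ^ b * G₂}) :
    Ideal.span ({PowerSeries.C (((p : ℕ) : PadicComplexInt p) ^ a) *
        PowerSeries.map J (PowerSeries.map (PowerSeries.constantCoeff (R := ℤ_[p])) F)} : Set (PowerSeries (PadicComplexInt p))) =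
      Ideal.span {PowerSeries.C (((p : ℕ) : PadicComplexInt p) ^ b) *
        PowerSeries.map (PowerSeries.constantCoeff (R := PadicComplexInt p)) G₂} := by
  have h := congrArg (Ideal.map (PowerSeries.map (PowerSeries.constantCoeff (R := PadicComplexInt p)))) hQ
  rw [map_span_singleton, map_span_singleton, map_mul, map_mul, map_pow, map_pow, map_natCast, map_constantCoeff_map_map] at h
  simp only [map_pow, map_natCast]
  exact h

/-- **`(ch_{Λ₂} D.X)(T₁,0) ≠ 0` FOR FREE** from (Q), (A) and `G₁ ≠ 0`: `p^a · (F(T₁,0))^J ∼ p^b · G₂(T₁,0) ∼ p^b · E · G₁ ≠ 0`.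
[cite: Washington1997, §13.2 (shape only)] -/
theorem map_constantCoeff_charIdeal_ne_bot_of_powForm (D : DualData₂ κ₁ κ₂ M vbar γ₁ γ₂)
    (J : ℤ_[p] →+* PadicComplexInt p) (G₂ : PowerSeries (PowerSeries (PadicComplexInt p)))
    (F : IwasawaAlgebra₂ p) (hF : charIdeal (IwasawaAlgebra₂ p) D.X = Ideal.span {F})
    {a b : ℕ} (hQ : Ideal.span ({((p : ℕ) : PowerSeries (PowerSeries (PadicComplexInt p))) ^ a *
        PowerSeries.map (PowerSeries.map J) F} : Set (PowerSeries (PowerSeries (PadicComplexInt p)))) =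
      Ideal.span {((p : ℕ) : PowerSeries (PowerSeries (PadicComplexInt p))) ^ b * G₂})
    (u : ℤ) (G₁ : PowerSeries (PadicComplexInt p)) (hG₁ : G₁ ≠ 0)
    (hA : Ideal.span ({PowerSeries.map (PowerSeries.constantCoeff (R := PadicComplexInt p)) G₂} : Set (PowerSeries (PadicComplexInt p))) =
      Ideal.span {((1 : PowerSeries (PadicComplexInt p)) + PowerSeries.X) - (u : PowerSeries (PadicComplexInt p))} * Ideal.span {G₁}) :
    (charIdeal (IwasawaAlgebra₂ p) D.X).map (PowerSeries.map (PowerSeries.constantCoeff (R := ℤ_[p]))) ≠ ⊥ := by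
  have hp0 : ((p : ℕ) : PadicComplexInt p) ≠ 0 := natCast_prime_padicComplexInt_ne_zero (p := p)
  have hk := span_C_pow_mul_line_eq_of_powForm J G₂ F hQ
  rw [one_add_X_sub_intCast_eq, Ideal.span_singleton_mul_span_singleton] at hA
  have hga : Associated (PowerSeries.map (PowerSeries.constantCoeff (R := PadicComplexInt p)) G₂)
      ((PowerSeries.X + PowerSeries.C ((1 : PadicComplexInt p) - (u : PadicComplexInt p))) * G₁) :=
    Ideal.span_singleton_eq_span_singleton.mp hA
  have hg0 : PowerSeries.map (PowerSeries.constantCoeff (R := PadicComplexInt p)) G₂ ≠ 0 :=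
    hga.ne_zero_iff.mpr (mul_ne_zero (X_add_C_ne_zero _) hG₁)
  have hka := Ideal.span_singleton_eq_span_singleton.mp hk
  have hCb : PowerSeries.C (((p : ℕ) : PadicComplexInt p) ^ b) ≠ 0 := fun h ↦
    pow_ne_zero b hp0 (PowerSeries.C_injective (h.trans (map_zero _).symm))
  have hf0 : PowerSeries.map J (PowerSeries.map (PowerSeries.constantCoeff (R := ℤ_[p])) F) ≠ 0 :=
    right_ne_zero_of_mul (hka.ne_zero_iff.mpr (mul_ne_zero hCb hg0))
  rw [hF, map_span_singleton, Ne, Ideal.span_singleton_eq_bot]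
  intro h0
  exact hf0 (by rw [h0, map_zero])

/-- **THE LINE PIN WITH FREE EULER EXPONENT (socket currency).** `D` a two-variable dual datum with `ch_{Λ₂} D.X = (F)`; (Q) the ⊗ℚ-form
`(p^a · F^J) = (p^b · G₂)`; the first-slot control identity `π(ch_{Λ₂} D.X) = ((1+T) − u)^c · I₁` in `Λ = ℤ_p⟦T⟧` with `p ∣ u − 1` and the
exponent `c` FREE ((C)∘(C2b), part 7, `I₁ = ch_Λ D₁.X`); (M) `I₁^J = (G₁)` with `G₁ ≠ 0` (Müller 2020 Thm 1.3); (A) `(G₂(T₁,0)) = ((1+T) − u)·(G₁)`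
(de Shalit II.4.12 restriction with the Euler factor at `v̄`) ⟹ **`c = 1`, `a = b`, and `(ch_{Λ₂} D.X).map (map (map J)) = (G₂)`** — the
conclusion of the socket `map_charIdeal_eq_span_of_powForm_of_firstLine` with its `hline` PRODUCED, and (LS)_v (`c = 1`) as a by-product.
[cite: Washington1997, §13.2 (shape only)] [cite: deShalit1987, II.4.12] [cite: Mueller2020MCSplitTwo, Thm. 1.3] -/
theorem eq_one_and_map_charIdeal_eq_span_of_powForm (D : DualData₂ κ₁ κ₂ M vbar γ₁ γ₂)
    (J : ℤ_[p] →+* PadicComplexInt p) (G₂ : PowerSeries (PowerSeries (PadicComplexInt p)))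
    (F : IwasawaAlgebra₂ p) (hF : charIdeal (IwasawaAlgebra₂ p) D.X = Ideal.span {F})
    {a b : ℕ} (hQ : Ideal.span ({((p : ℕ) : PowerSeries (PowerSeries (PadicComplexInt p))) ^ a *
        PowerSeries.map (PowerSeries.map J) F} : Set (PowerSeries (PowerSeries (PadicComplexInt p)))) =
      Ideal.span {((p : ℕ) : PowerSeries (PowerSeries (PadicComplexInt p))) ^ b * G₂})
    {u : ℤ} (hpu : (p : ℤ) ∣ u - 1) {c : ℕ} {I₁ : Ideal (IwasawaAlgebra p)}
    (hC : (charIdeal (IwasawaAlgebra₂ p) D.X).map (PowerSeries.map (PowerSeries.constantCoeff (R := ℤ_[p]))) =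
      Ideal.span {((1 : IwasawaAlgebra p) + PowerSeries.X) - (u : IwasawaAlgebra p)} ^ c * I₁)
    (G₁ : PowerSeries (PadicComplexInt p)) (hG₁ : G₁ ≠ 0) (hM : I₁.map (PowerSeries.map J) = Ideal.span {G₁})
    (hA : Ideal.span ({PowerSeries.map (PowerSeries.constantCoeff (R := PadicComplexInt p)) G₂} : Set (PowerSeries (PadicComplexInt p))) =
      Ideal.span {((1 : PowerSeries (PadicComplexInt p)) + PowerSeries.X) - (u : PowerSeries (PadicComplexInt p))} * Ideal.span {G₁}) :
    c = 1 ∧ a = b ∧ (charIdeal (IwasawaAlgebra₂ p) D.X).map (PowerSeries.map (PowerSeries.map J)) = Ideal.span {G₂} := by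
  have hp0 : ((p : ℕ) : PadicComplexInt p) ≠ 0 := natCast_prime_padicComplexInt_ne_zero (p := p)
  -- (Q) on the line
  have hk := span_C_pow_mul_line_eq_of_powForm J G₂ F hQ
  -- (C)∘(C2b)∘(M) on the line, after `J`
  have hf : Ideal.span ({PowerSeries.map J (PowerSeries.map (PowerSeries.constantCoeff (R := ℤ_[p])) F)} :
        Set (PowerSeries (PadicComplexInt p))) =
      Ideal.span {PowerSeries.X + PowerSeries.C ((1 : PadicComplexInt p) - (u : PadicComplexInt p))} ^ c * Ideal.span {G₁} := by
    have h := congrArg (Ideal.map (PowerSeries.map J)) hC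
    rw [hF, map_span_singleton, map_span_singleton, Ideal.map_mul, Ideal.map_pow, map_span_singleton, hM, map_sub, map_add,
      map_one, PowerSeries.map_X, map_intCast, one_add_X_sub_intCast_eq] at h
    exact h
  rw [one_add_X_sub_intCast_eq] at hA
  obtain ⟨hc, hline, hf0⟩ := eq_one_and_span_eq_of_span_C_mul_eq (not_isUnit_one_sub_intCast_padicComplexInt hpu)
    (pow_ne_zero a hp0) (pow_ne_zero b hp0) hG₁ hk hf hA
  obtain ⟨hab, h⟩ := map_charIdeal_eq_span_of_powForm_of_firstLine D J G₂ F hF hQ hline hf0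
  exact ⟨hc, hab, h⟩

end Socket

/-! ## §3. With part 7: the slot-1 control data + (Q) + (M) + (A) + S3n′ ⟹ (LS)_v ∧ the crux's clause -/

section Junction

variable {K : Type} [Field K] [NumberField K] {p : ℕ} [Fact p.Prime] {κ κ₂ : ZpExtension K p}
  {M : Type} [AddCommGroup M] [DistribMulAction (absoluteGaloisGroup K) M] [TopologicalSpace M] [DiscreteTopology M]
  {𝔮 : HeightOneSpectrum (𝓞 K)} {γ γ₂ : absoluteGaloisGroup K}
  {g : unrSelmer κ M 𝔮 ∅ →+ unrSelmer₂ κ κ₂ M 𝔮}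
  (hg : ∀ t : unrSelmer κ M 𝔮 ∅,
    ((g t : unrSelmer₂ κ κ₂ M 𝔮) : subgroupH1 (ZpExtension.pairKer κ κ₂) M) =
      resOfLe M (ZpExtension.pairKer_le_left κ κ₂) (t : subgroupH1 κ.kerSubgroup M))
  {D₂ : DualData₂ κ κ₂ M 𝔮 γ γ₂} {D₁ : DatumDualData κ γ M (Castella2018.AcSelmer.bdpData M p 𝔮) ∅}
  {φ : D₂.X →ₛₗ[PowerSeries.map (PowerSeries.constantCoeff (R := ℤ_[p]))] D₁.X}
  (hφ : ∀ (x : D₂.X) (t : unrSelmer κ M 𝔮 ∅), D₁.toDual (φ x) t = D₂.toDual x (g t))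
include hg hφ

/-- **M-LINE-PIN ASSEMBLED ON THE FIRST SLOT (generic `𝔮 ∣ p` undecomposed in the line): (Q) + (M) + (A) + control ⟹ (LS)_v ∧ `a = b` ∧ the
two-variable clause.** Hypotheses: the slot-1 control `g` (finite kernel) with transpose `φ` into the Greenberg–Vatsal datum `D₁` and a presentation
`πC` of its cokernel on the `γ₂`-invariants; `M` discrete `p`-primary with continuous orbits; `κ₂` unramified outside `𝔮 ∣ p`; the even local class
`hI`; `τ ∈ D_𝔮` with `κ τ = κ γ` acting on `M` as `u ≡ 1 (mod p)`; `D₂.X` f.g. with S3n′ (`hfin`); `D₁.X` TORSION with `(ch_Λ D₁.X)^J = (G₁)`,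
`G₁ ≠ 0` ((M)); a generator `F` of `ch_{Λ₂} D₂.X` with the ⊗ℚ-form `(p^a F^J) = (p^b G₂)` ((Q)); `(G₂(T₁,0)) = ((1+T) − u)·(G₁)` ((A)). THEN:
`D₂.X` is `Λ₂`-torsion, **`corank_{ℤ_p} C = 1`** (the cokernel of the slot-1 control has `ℤ_p`-corank exactly one — (LS)_v as a THEOREM of the
line), `a = b`, and **`(ch_{Λ₂} D₂.X).map (map (map J)) = (G₂)`**. [cite: GreenbergVatsal2000, §2 Prop. (2.4) (p. 22)]
[cite: GreenbergLNM1716, §4 Lemma 4.2] [cite: Washington1997, §13.2] [cite: deShalit1987, II.4.12] [cite: Mueller2020MCSplitTwo, Thm. 1.3] -/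
theorem zpCorank_eq_one_and_map_charIdeal_eq_span_of_powForm [Module.Finite (IwasawaAlgebra₂ p) D₂.X] [Finite g.ker]
    (hγ : ZpExtension.IsTopGeneratorPair κ κ₂ γ γ₂)
    (hcont : ∀ m : M, Continuous fun σ : absoluteGaloisGroup K ↦ σ • m) (hprim : ∀ m : M, ∃ k : ℕ, p ^ k • m = 0)
    (hκ₂ : κ₂.IsUnramifiedOutside 𝔮) (h𝔮 : ((p : ℕ) : 𝓞 K) ∈ 𝔮.asIdeal)
    (hI : ∀ y : absoluteGaloisGroup K, y ∈ ZpExtension.pairKer κ κ₂ → y ∈ inertia 𝔮 → ∀ m : M, y • m = m)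
    {τ : absoluteGaloisGroup K} (hτ : τ ∈ decomp 𝔮) (hκτ : κ τ = κ γ) {u : ℤ} (hu : ∀ m : M, τ • m = u • m)
    (hpu : (p : ℤ) ∣ u - 1)
    {C : Type*} [AddCommGroup C] (πC : ↥(endInvariants (conjSel₂ κ κ₂ M 𝔮 γ₂ - 1)) →+ C) (hsurj : Function.Surjective πC)
    (hker : ∀ s : ↥(endInvariants (conjSel₂ κ κ₂ M 𝔮 γ₂ - 1)), πC s = 0 ↔ (s : unrSelmer₂ κ κ₂ M 𝔮) ∈ g.range)
    (hD₁ : Module.IsTorsion (IwasawaAlgebra p) D₁.X)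
    (hfin : ∀ N : Submodule (IwasawaAlgebra₂ p) D₂.X, Module.IsPseudoNull (IwasawaAlgebra₂ p) N → Finite N)
    (J : ℤ_[p] →+* PadicComplexInt p) (G₂ : PowerSeries (PowerSeries (PadicComplexInt p)))
    (F : IwasawaAlgebra₂ p) (hF : charIdeal (IwasawaAlgebra₂ p) D₂.X = Ideal.span {F})
    {a b : ℕ} (hQ : Ideal.span ({((p : ℕ) : PowerSeries (PowerSeries (PadicComplexInt p))) ^ a *
        PowerSeries.map (PowerSeries.map J) F} : Set (PowerSeries (PowerSeries (PadicComplexInt p)))) =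
      Ideal.span {((p : ℕ) : PowerSeries (PowerSeries (PadicComplexInt p))) ^ b * G₂})
    (G₁ : PowerSeries (PadicComplexInt p)) (hG₁ : G₁ ≠ 0)
    (hM : (charIdeal (IwasawaAlgebra p) D₁.X).map (PowerSeries.map J) = Ideal.span {G₁})
    (hA : Ideal.span ({PowerSeries.map (PowerSeries.constantCoeff (R := PadicComplexInt p)) G₂} : Set (PowerSeries (PadicComplexInt p))) =
      Ideal.span {((1 : PowerSeries (PadicComplexInt p)) + PowerSeries.X) - (u : PowerSeries (PadicComplexInt p))} * Ideal.span {G₁}) :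
    Module.IsTorsion (IwasawaAlgebra₂ p) D₂.X ∧ zpCorank C p = 1 ∧ a = b ∧
      (charIdeal (IwasawaAlgebra₂ p) D₂.X).map (PowerSeries.map (PowerSeries.map J)) = Ideal.span {G₂} := by
  -- `(ch)(T₁,0) ≠ 0` for free
  have hne := map_constantCoeff_charIdeal_ne_bot_of_powForm D₂ J G₂ F hF hQ u G₁ hG₁ hA
  -- part 7: the first-slot identity with free exponent
  obtain ⟨htors, -, hC⟩ := map_charIdeal_eq_span_pow_zpCorank_mul hg hφ hγ hcont hprim hκ₂ h𝔮 hI hτ hκτ hu hpu πC hsurj hker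
    hD₁ hne hfin
  obtain ⟨hc, hab, h⟩ := eq_one_and_map_charIdeal_eq_span_of_powForm D₂ J G₂ F hF hQ hpu hC G₁ hG₁ hM hA
  exact ⟨htors, hc, hab, h⟩

end Junction


end Summit.BirchSwinnertonDyer.BirchSwinnertonDyer.Theorems.PrintCf2.LinePin

end
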